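import Summits.QuantumFields.BalabanUV.Beta.GAN24.SubAveragingCoreEstimate

/-!
# `BalabanUV.Beta.GAN24.SubAveragingFibre` — binder row G-an2-4 ∕ (CONV-C), programme «SUBAVG-RATE»
# (ROUTES-GAN24 R2-S1∕S2 ∘ R3-S3 executed at `U = 1` in the fibre∕strip currency), FILE 3a:
# THE FIBRE COLUMNS — the regrouped column factor `S_k` of the once-sub-averaged finer `G_jQ_j^*`, the two regrouped
# denominators `E(n·L)`, `E(n)` of B4 (2.48), and the COLUMN DIFFERENCE `S_k∕E(nL) − R_k∕E(n) = O(n⁻²)` on the fat region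

NOT IN PRINT; OUR PROOF ATTEMPT (prover part P3 of row G-an2-4, fibre∕strip lineage, gen 22; CRUX TEAM (2), ruling «YM REDIRECT
TOWARDS THE SUMMIT», 2026-08-21).  HONEST DEPENDENCY (cell records, verbatim): «continuum YM on T⁴ ⇐ BetaPertH ∧ nine spine
estimates (0/9 proved); BetaPertH ⇐ (D1) ∧ (D4) ∧ CAP+tail; G-an2-4 gates asym, D1 and NE2/3/4.»  HONEST FRAMING (cell contract,
verbatim): «discharging `BetaPertH` makes Bałaban's UV stability UNCONDITIONAL — a real constructive-QFT result; it is NOT the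
continuum limit and NOT the Clay problem.»  ABSOLUTE RULE: nothing printed is a hypothesis; [folklore] algebra and estimates over
`Literature.….B4Strip` (`U`, `E`, `DeltaXi`), `B4StripCauchy` (`Fat`, `sum_norm_U_le`, `norm_DeltaXi_le`), `B4StripSums` (`R`, `CR`,
`norm_R_le`) — vendored there with their citation tags — and the siblings `SubAveragingDirichlet` ∕ `Core` ∕ `CoreEstimate`.

## The objects (B4 (2.48) at the two levels `n` and `n·L`, same unit-lattice `a`, `m²`)

The level-`n` multiplier of `G_jQ_j^*` is `Σ_k F n τ k p · R n m2 k p ∕ E n a m2 p` (`B4StripSums.G`); the finer multiplier, averaged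
over the `L^d` sub-sites of a coarse fine site, is `Σ_k F n τ k p · S_k(p) ∕ E (n·L) a m2 p` (FILE 4) with the REGROUPED COLUMN FACTOR
**`S n L m2 k p := Σ_m W1(Kof k m)(p) · R (n·L) m2 (Kof k m) p`** (`= (Δ^{ξ∕L}+m²)(p)·T_k(p)` for `k ≠ 0`, `S_eq_mul_T`).

## What is proved (every `d`, `n, L ≥ 1`, `m² ≥ 0`, `p ∈ Fat d r`, `r ≤ 1∕4`, `d r² ≤ 1∕16`)
* §1 `S`, `S_eq_mul_T`; **`norm_S_sub_R_le`** (`‖S_k − R_k‖ ≤ CSR∕n²` for EVERY `k`: `k ≠ 0` from the core estimate, `k = 0` from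
  `‖W1(0) − 1‖ = O(Σ‖p_ν‖²∕n²)` and the far sub-aliases of `0`); `norm_R_le_CR` (`‖R_k‖ ≤ CR` for every `k`).
* (sibling `SubAveragingFibreColumn`, FILE 3b): the alias re-indexing `K ↔ (k, m)`, the factorisation `U (n·L) (Kof k m) = U n k · W1`,
  the two regrouped denominators `E = Δ + aΣ U_k R_k`, `E(n·L) = Δ′ + aΣ U_k S_k`, `‖E(n·L) − E(n)‖ ≤ CE∕n²`, and the column difference
  `‖S_k∕E(nL) − R_k∕E(n)‖ ≤ Ccol∕n²`.

NOT HERE: FILE 3b; the multiplier identity and the kernels (FILE 4 `SubAveragingKernel`).  0∕4 row-D1 binders touched; NEVER «G-an2-4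
closed»; NOT D1, NOT BetaPertH, NOT continuum, NOT Clay.  Provenance: prover-b2b-balaban-gan24-p3-g22-0 (unit `b2b-balaban-gan24-p3`,
gen 22), 2026-08-21.
-/

noncomputable section

namespace Summit.QuantumFields.BalabanUV.Beta.GAN24.SubAveragingFibre

open Complex Finset
open Literature.MathematicalPhysics.QuantumFieldTheory.Balaban1983to89
open Literature.MathematicalPhysics.QuantumFieldTheory.Balaban1983to89.B4Strip
open Literature.MathematicalPhysics.QuantumFieldTheory.Balaban1983to89.B4StripCauchy
open Literature.MathematicalPhysics.QuantumFieldTheory.Balaban1983to89.B4StripSums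
open Literature.MathematicalPhysics.QuantumFieldTheory.Balaban1983to89.B5Strip145Analytic (Sxi_add_nat_mul)
open Summit.QuantumFields.BalabanUV.Beta.GAN24.SubAveragingDirichlet
open Summit.QuantumFields.BalabanUV.Beta.GAN24.SubAveragingCore
open Summit.QuantumFields.BalabanUV.Beta.GAN24.SubAveragingCoreEstimate
open scoped Real

variable {d : ℕ}

/-! ## §1 The regrouped column factor `S_k` and `‖S_k − R_k‖ = O(n⁻²)` -/

/-- [folklore] THE REGROUPED COLUMN FACTOR of the once-sub-averaged finer `G_jQ_j^*` at the coarse alias `k`: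
`S_k(p) = Σ_m W1(Kof k m)(p) · R_{nL}(Kof k m)(p)`. -/
def S (n L : ℕ) [NeZero n] [NeZero L] (m2 : ℝ) (k : Fin d → Fin n) (p : Fin d → ℂ) : ℂ :=
  ∑ m : Fin d → Fin L, W1 n L (Kof n L k m) p * R (n * L) m2 (Kof n L k m) p

/-- [folklore] for `k ≠ 0`: `S_k = (Δ^{ξ∕L}+m²)(p) · T_k` (every finer alias above `k` is non-zero, so `R_{nL}` is the ratio). -/
theorem S_eq_mul_T (n L : ℕ) [NeZero n] [NeZero L] (m2 : ℝ) {k : Fin d → Fin n} (hk : k ≠ fun _ => 0) (p : Fin d → ℂ) :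
    S n L m2 k p = DeltaXi (n * L) m2 p * T n L m2 k p := by
  unfold S T
  rw [Finset.mul_sum]
  refine Finset.sum_congr rfl fun m _ => ?_
  unfold R
  rw [if_neg (Kof_ne_zero n L hk m)]
  ring

/-- [folklore] `‖p_ν‖ ≤ 4` on the fat region (`r ≤ 1∕4`). -/
theorem norm_coord_le {r : ℝ} (hr : r ≤ 1 / 4) {p : Fin d → ℂ} (hp : p ∈ Fat d r) (ν : Fin d) : ‖p ν‖ ≤ 4 := by
  have h1 := (hp ν).1
  have h2 := (hp ν).2
  have hπ := Real.pi_lt_d2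
  calc ‖p ν‖ ≤ |(p ν).re| + |(p ν).im| := Complex.norm_le_abs_re_add_abs_im _
    _ ≤ 4 := by linarith

/-- [folklore] `‖(Δ^{ξ∕L}+m²)(p) − (Δ^ξ+m²)(p)‖ ≤ 512·d∕n²` on the fat region (FILE 1 coordinatewise, `‖p_ν‖ ≤ 4`). -/
theorem norm_DeltaXi_mul_sub_le (n L : ℕ) [NeZero n] [NeZero L] (m2 : ℝ) {r : ℝ} (hr : r ≤ 1 / 4) {p : Fin d → ℂ}
    (hp : p ∈ Fat d r) : ‖DeltaXi (n * L) m2 p - DeltaXi n m2 p‖ ≤ 512 * (d : ℝ) / (n : ℝ) ^ 2 := by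
  have hn : 1 ≤ n := Nat.pos_of_ne_zero (NeZero.ne n)
  have hL : 1 ≤ L := Nat.pos_of_ne_zero (NeZero.ne L)
  have hn0 : (0 : ℝ) < n := by exact_mod_cast hn
  unfold DeltaXi
  rw [add_sub_add_right_eq_sub, ← Finset.sum_sub_distrib]
  refine (norm_sum_le _ _).trans ?_
  have h : ∀ ν ∈ (Finset.univ : Finset (Fin d)), ‖Sxi (n * L) (p ν) - Sxi n (p ν)‖ ≤ 512 / (n : ℝ) ^ 2 := by
    intro ν _
    rw [norm_sub_rev]
    have h1 := norm_Sxi_sub_Sxi_mul_le n L hn hL (p ν) (fat_coord hr hp ν).2.2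
    have h2 : ‖p ν‖ ^ 4 ≤ 4 ^ 4 := pow_le_pow_left₀ (norm_nonneg _) (norm_coord_le hr hp ν) 4
    calc ‖Sxi n (p ν) - Sxi (n * L) (p ν)‖ ≤ 2 * ‖p ν‖ ^ 4 / (n : ℝ) ^ 2 := h1
      _ ≤ 2 * 4 ^ 4 / (n : ℝ) ^ 2 := by gcongr
      _ = 512 / (n : ℝ) ^ 2 := by norm_num
  refine (Finset.sum_le_sum h).trans ?_
  rw [Finset.sum_const, Finset.card_univ, Fintype.card_fin, nsmul_eq_mul]
  ring_nf
  rfl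

/-- [folklore] the constant of `‖S_k − R_k‖` for `k ≠ 0`. -/
def CS (d L : ℕ) (m2 : ℝ) : ℝ := 512 * (d : ℝ) * ((L : ℝ) ^ d * 4 ^ d * (64 / 7)) + (16 * (d : ℝ) + m2) * CT d L m2

/-- [folklore] the constant of `‖S_0 − 1‖`. -/
def C0 (d L : ℕ) (m2 : ℝ) : ℝ := 4 ^ d * 12 * (d : ℝ) + (L : ℝ) ^ d * (4 ^ d * (16 * (d : ℝ) + m2) * (256 / 7))

/-- [folklore] the combined constant `CSR = CS + C0` of `‖S_k − R_k‖` for every `k`. -/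
def CSR (d L : ℕ) (m2 : ℝ) : ℝ := CS d L m2 + C0 d L m2

/-- [folklore] `CS, C0, CSR ≥ 0`. -/
theorem CSR_nonneg (d L : ℕ) {m2 : ℝ} (hm : 0 ≤ m2) : 0 ≤ CS d L m2 ∧ 0 ≤ C0 d L m2 ∧ 0 ≤ CSR d L m2 := by
  have h := CT_nonneg d L hm
  have h1 : 0 ≤ CS d L m2 := by unfold CS; positivity
  have h2 : 0 ≤ C0 d L m2 := by unfold C0; positivity
  exact ⟨h1, h2, by unfold CSR; linarith⟩

/-- [folklore] `‖S_k − R_k‖ ≤ CS∕n²` for a NON-ZERO coarse alias (the core estimate `norm_T_sub_inv_le`, dressed by the base symbols). -/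
theorem norm_S_sub_R_le_ne (n L : ℕ) [NeZero n] [NeZero L] (m2 : ℝ) (hm : 0 ≤ m2) {r : ℝ} (hr : r ≤ 1 / 4)
    (hdr : (d : ℝ) * r ^ 2 ≤ 1 / 16) {p : Fin d → ℂ} (hp : p ∈ Fat d r) {k : Fin d → Fin n} (hk : k ≠ fun _ => 0) :
    ‖S n L m2 k p - R n m2 k p‖ ≤ CS d L m2 / (n : ℝ) ^ 2 := by
  have hn : 1 ≤ n := Nat.pos_of_ne_zero (NeZero.ne n)
  have hn0 : (0 : ℝ) < n := by exact_mod_cast hn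
  rw [S_eq_mul_T n L m2 hk]
  have hR : R n m2 k p = DeltaXi n m2 p / DeltaXi n m2 (shift n k p) := by unfold R; rw [if_neg hk]
  rw [hR]
  set A0' := DeltaXi (n * L) m2 p
  set A0 := DeltaXi n m2 p
  set Ak := DeltaXi n m2 (shift n k p)
  have e : A0' * T n L m2 k p - A0 / Ak = (A0' - A0) * T n L m2 k p + A0 * (T n L m2 k p - Ak⁻¹) := by ring
  rw [e]
  have h1 := norm_DeltaXi_mul_sub_le n L m2 hr hp
  have h2 := norm_T_le n L m2 hm hr hdr hp hk
  have h3 := norm_DeltaXi_le n hn m2 hm hr hp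
  have h4 := norm_T_sub_inv_le n L m2 hm hr hdr hp hk
  calc ‖(A0' - A0) * T n L m2 k p + A0 * (T n L m2 k p - Ak⁻¹)‖
      ≤ ‖A0' - A0‖ * ‖T n L m2 k p‖ + ‖A0‖ * ‖T n L m2 k p - Ak⁻¹‖ := by
        refine (norm_add_le _ _).trans ?_; rw [norm_mul, norm_mul]
    _ ≤ (512 * (d : ℝ) / (n : ℝ) ^ 2) * ((L : ℝ) ^ d * 4 ^ d * (64 / 7)) + (16 * (d : ℝ) + m2) * (CT d L m2 / (n : ℝ) ^ 2) := by
        gcongr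
    _ = CS d L m2 / (n : ℝ) ^ 2 := by unfold CS; field_simp

/-- [folklore] the principal sub-alias of the ZERO coarse alias is `0`. -/
theorem Mstar_zero (n L : ℕ) [NeZero n] [NeZero L] : Mstar n L (fun _ : Fin d => (0 : Fin n)) = fun _ => 0 := by
  funext ν
  apply Fin.ext
  show ((mstar n L (0 : Fin n) : Fin L) : ℕ) = ((0 : Fin L) : ℕ)
  rw [mstar_val, Fin.val_zero, Fin.val_zero, if_pos]
  simpa using Nat.pos_of_ne_zero (NeZero.ne n)

/-- [folklore] `Kof 0 0 = 0`. -/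
theorem Kof_zero (n L : ℕ) [NeZero n] [NeZero L] : Kof n L (fun _ : Fin d => (0 : Fin n)) (fun _ => (0 : Fin L)) = fun _ => 0 := by
  funext ν; apply Fin.ext; simp [Kof_val]

/-- [folklore] `‖S_0 − 1‖ ≤ C0∕n²` — the ZERO coarse alias: `W1(0) = Π_ν swc(p_ν)` is `1 + O(Σ‖p_ν‖²∕n²)`, and every other sub-alias
of `0` is far (`W_{nL} ≥ n²∕4`), its `R`-ratio `O((16d+m²)∕n²)`. -/
theorem norm_S_zero_sub_one_le (n L : ℕ) [NeZero n] [NeZero L] (m2 : ℝ) (hm : 0 ≤ m2) {r : ℝ} (hr : r ≤ 1 / 4)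
    (hdr : (d : ℝ) * r ^ 2 ≤ 1 / 16) {p : Fin d → ℂ} (hp : p ∈ Fat d r) :
    ‖S n L m2 (fun _ => 0) p - 1‖ ≤ C0 d L m2 / (n : ℝ) ^ 2 := by
  have hn : 1 ≤ n := Nat.pos_of_ne_zero (NeZero.ne n)
  have hL : 1 ≤ L := Nat.pos_of_ne_zero (NeZero.ne L)
  have hn0 : (0 : ℝ) < n := by exact_mod_cast hn
  -- split off the sub-alias `m = 0`
  have hsplit : S n L m2 (fun _ => 0) p = W1 n L (fun _ => 0) p
      + ∑ m ∈ Finset.univ.erase (fun _ => (0 : Fin L)), W1 n L (Kof n L (fun _ => 0) m) p * R (n * L) m2 (Kof n L (fun _ => 0) m) p := by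
    unfold S
    rw [← Finset.add_sum_erase _ _ (Finset.mem_univ (fun _ => (0 : Fin L))), Kof_zero]
    congr 1
    unfold R; rw [if_pos rfl, mul_one]
  rw [hsplit, add_sub_right_comm]
  refine (norm_add_le _ _).trans ?_
  -- (a) the principal term `W1(0) − 1`
  have ha : ‖W1 n L (fun _ => (0 : Fin (n * L))) p - 1‖ ≤ 4 ^ d * 12 * (d : ℝ) / (n : ℝ) ^ 2 := by
    unfold W1
    have key := norm_prod_sub_one_le (Finset.univ : Finset (Fin d)) (fun ν => sw n L ((fun _ => (0 : Fin (n * L))) ν : ℕ) (p ν))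
      (B := 4) (by norm_num) (fun _ => 12 / (n : ℝ) ^ 2) (fun ν _ => by positivity)
      (fun ν _ => norm_sw_le n L hn hL _ _ (fat_coord hr hp ν).2.2)
      (fun ν _ => by
        have h := norm_sw_sub_one_le n L hn hL 0 (p ν) (fat_coord hr hp ν).2.2
        simp only [Fin.val_zero, Nat.cast_zero, mul_zero, add_zero] at h ⊢
        rw [norm_ang] at h
        have hν := norm_coord_le hr hp ν
        have hL1 : (1 : ℝ) ≤ L := by exact_mod_cast hL
        calc ‖sw n L 0 (p ν) - 1‖ ≤ 3 * (L : ℝ) ^ 2 * (‖p ν‖ / (2 * n * L)) ^ 2 := h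
          _ = 3 * ‖p ν‖ ^ 2 / (4 * (n : ℝ) ^ 2) := by field_simp; ring
          _ ≤ 3 * 4 ^ 2 / (4 * (n : ℝ) ^ 2) := by gcongr
          _ = 12 / (n : ℝ) ^ 2 := by ring)
    rw [Finset.card_univ, Fintype.card_fin, Finset.sum_const, Finset.card_univ, Fintype.card_fin, nsmul_eq_mul] at key
    calc ‖∏ ν, sw n L ((fun _ => (0 : Fin (n * L))) ν : ℕ) (p ν) - 1‖ ≤ 4 ^ d * ((d : ℝ) * (12 / (n : ℝ) ^ 2)) := key
      _ = 4 ^ d * 12 * (d : ℝ) / (n : ℝ) ^ 2 := by ring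
  -- (b) the far sub-aliases of `0`
  have hb : ‖∑ m ∈ Finset.univ.erase (fun _ => (0 : Fin L)),
      W1 n L (Kof n L (fun _ => 0) m) p * R (n * L) m2 (Kof n L (fun _ => 0) m) p‖
      ≤ (L : ℝ) ^ d * (4 ^ d * (16 * (d : ℝ) + m2) * (256 / 7)) / (n : ℝ) ^ 2 := by
    refine (norm_sum_le _ _).trans ?_
    have hterm : ∀ m ∈ Finset.univ.erase (fun _ => (0 : Fin L)),
        ‖W1 n L (Kof n L (fun _ => 0) m) p * R (n * L) m2 (Kof n L (fun _ => 0) m) p‖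
          ≤ 4 ^ d * (16 * (d : ℝ) + m2) * (256 / 7) / (n : ℝ) ^ 2 := by
      intro m hm'
      have hne : m ≠ Mstar n L (fun _ : Fin d => (0 : Fin n)) := by rw [Mstar_zero]; exact Finset.ne_of_mem_erase hm'
      have hWfar := W_Kof_far n L (fun _ => 0) m hne
      have hKne : Kof n L (fun _ : Fin d => (0 : Fin n)) m ≠ fun _ => 0 := by
        intro h
        apply Finset.ne_of_mem_erase hm'
        funext ν
        have h0 : ((Kof n L (fun _ : Fin d => (0 : Fin n)) m ν : Fin (n * L)) : ℕ) = 0 := by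
          rw [congrFun h ν]; exact Fin.val_zero _
        exact Fin.ext (by rw [Fin.val_zero]; exact ((Kof_apply_eq_zero_iff n L _ m ν).mp h0).2)
      have hAK := (re_DeltaXi_shift_ge_W (n * L) m2 hm hr hdr hp _ hKne).trans (Complex.re_le_norm _)
      have hAK' : 7 / 64 * ((n : ℝ) ^ 2 / 4) ≤ ‖DeltaXi (n * L) m2 (shift (n * L) (Kof n L (fun _ => 0) m) p)‖ := by nlinarith
      have hApos : 0 < ‖DeltaXi (n * L) m2 (shift (n * L) (Kof n L (fun _ => 0) m) p)‖ := lt_of_lt_of_le (by positivity) hAK'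
      have hA0 := norm_DeltaXi_le (n * L) (Nat.one_le_iff_ne_zero.mpr (Nat.mul_ne_zero (NeZero.ne n) (NeZero.ne L))) m2 hm hr hp
      have hW1 := norm_W1_le n L hn hL (Kof n L (fun _ => 0) m) (p := p) (fun ν => (fat_coord hr hp ν).2.2)
      have hRe : R (n * L) m2 (Kof n L (fun _ => 0) m) p
          = DeltaXi (n * L) m2 p / DeltaXi (n * L) m2 (shift (n * L) (Kof n L (fun _ => 0) m) p) := by
        unfold R; rw [if_neg hKne]
      rw [norm_mul, hRe, norm_div]
      have hd0 : (0 : ℝ) ≤ 16 * (d : ℝ) + m2 := by positivity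
      calc ‖W1 n L (Kof n L (fun _ => 0) m) p‖ * (‖DeltaXi (n * L) m2 p‖ / ‖DeltaXi (n * L) m2 (shift (n * L) (Kof n L (fun _ => 0) m) p)‖)
          ≤ 4 ^ d * ((16 * (d : ℝ) + m2) / (7 / 64 * ((n : ℝ) ^ 2 / 4))) := by
            gcongr
        _ = 4 ^ d * (16 * (d : ℝ) + m2) * (256 / 7) / (n : ℝ) ^ 2 := by field_simp; ring
    refine (Finset.sum_le_sum hterm).trans ?_
    rw [Finset.sum_const, nsmul_eq_mul]
    have hcard : ((Finset.univ.erase (fun _ : Fin d => (0 : Fin L))).card : ℝ) ≤ (L : ℝ) ^ d := by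
      have h1 := Finset.card_erase_le (s := (Finset.univ : Finset (Fin d → Fin L))) (a := fun _ => (0 : Fin L))
      have h2 : (Finset.univ : Finset (Fin d → Fin L)).card = L ^ d := by
        rw [Finset.card_univ, Fintype.card_pi, Finset.prod_const, Fintype.card_fin, Finset.card_univ, Fintype.card_fin]
      have : ((Finset.univ.erase (fun _ : Fin d => (0 : Fin L))).card : ℝ) ≤ ((L ^ d : ℕ) : ℝ) := by exact_mod_cast h2 ▸ h1
      simpa using this
    have h0 : (0 : ℝ) ≤ 4 ^ d * (16 * (d : ℝ) + m2) * (256 / 7) / (n : ℝ) ^ 2 := by positivity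
    calc ((Finset.univ.erase (fun _ : Fin d => (0 : Fin L))).card : ℝ) * (4 ^ d * (16 * (d : ℝ) + m2) * (256 / 7) / (n : ℝ) ^ 2)
        ≤ (L : ℝ) ^ d * (4 ^ d * (16 * (d : ℝ) + m2) * (256 / 7) / (n : ℝ) ^ 2) := mul_le_mul_of_nonneg_right hcard h0
      _ = (L : ℝ) ^ d * (4 ^ d * (16 * (d : ℝ) + m2) * (256 / 7)) / (n : ℝ) ^ 2 := by ring
  calc ‖W1 n L (fun _ => 0) p - 1‖ + ‖∑ m ∈ Finset.univ.erase (fun _ => (0 : Fin L)),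
        W1 n L (Kof n L (fun _ => 0) m) p * R (n * L) m2 (Kof n L (fun _ => 0) m) p‖
      ≤ 4 ^ d * 12 * (d : ℝ) / (n : ℝ) ^ 2 + (L : ℝ) ^ d * (4 ^ d * (16 * (d : ℝ) + m2) * (256 / 7)) / (n : ℝ) ^ 2 := add_le_add ha hb
    _ = C0 d L m2 / (n : ℝ) ^ 2 := by unfold C0; field_simp

/-- [folklore] **`‖S_k − R_k‖ ≤ CSR∕n²` FOR EVERY coarse alias `k`** on the fat region. -/
theorem norm_S_sub_R_le (n L : ℕ) [NeZero n] [NeZero L] (m2 : ℝ) (hm : 0 ≤ m2) {r : ℝ} (hr : r ≤ 1 / 4)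
    (hdr : (d : ℝ) * r ^ 2 ≤ 1 / 16) {p : Fin d → ℂ} (hp : p ∈ Fat d r) (k : Fin d → Fin n) :
    ‖S n L m2 k p - R n m2 k p‖ ≤ CSR d L m2 / (n : ℝ) ^ 2 := by
  obtain ⟨hCS, hC0, -⟩ := CSR_nonneg d L hm
  have hn0 : (0 : ℝ) < n := by exact_mod_cast Nat.pos_of_ne_zero (NeZero.ne n)
  unfold CSR
  by_cases hk : k = fun _ => 0
  · subst hk
    have hR : R n m2 (fun _ : Fin d => (0 : Fin n)) p = 1 := by unfold R; rw [if_pos rfl]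
    rw [hR]
    refine (norm_S_zero_sub_one_le n L m2 hm hr hdr hp).trans ?_
    rw [add_div]; linarith [div_nonneg hCS (le_of_lt (by positivity : (0 : ℝ) < (n : ℝ) ^ 2))]
  · refine (norm_S_sub_R_le_ne n L m2 hm hr hdr hp hk).trans ?_
    rw [add_div]; linarith [div_nonneg hC0 (le_of_lt (by positivity : (0 : ℝ) < (n : ℝ) ^ 2))]

/-- [folklore] `‖R_k‖ ≤ CR(d, m²)` for EVERY `k` on the fat region (`B4StripSums.norm_R_le` for `k ≠ 0` with `W ≥ 1`; `R_0 = 1 ≤ CR`). -/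
theorem norm_R_le_CR (n : ℕ) [NeZero n] (m2 : ℝ) (hm : 0 ≤ m2) {r : ℝ} (hr : r ≤ 1 / 4) (hdr : (d : ℝ) * r ^ 2 ≤ 1 / 16)
    {p : Fin d → ℂ} (hp : p ∈ Fat d r) (k : Fin d → Fin n) : ‖R n m2 k p‖ ≤ CR d m2 := by
  by_cases hk : k = fun _ => 0
  · subst hk
    have hR : R n m2 (fun _ : Fin d => (0 : Fin n)) p = 1 := by unfold R; rw [if_pos rfl]
    rw [hR, norm_one]
    unfold CR
    have : (0 : ℝ) ≤ d := Nat.cast_nonneg d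
    nlinarith
  · have h := norm_R_le n m2 hm hr hdr hp k hk
    have hW := one_le_W n k hk
    have hd : (0 : ℝ) ≤ 16 * d + m2 := by have : (0 : ℝ) ≤ d := Nat.cast_nonneg d; positivity
    unfold CR
    calc ‖R n m2 k p‖ ≤ (16 * d + m2) * (64 / 7) / W n k := h
      _ ≤ (16 * d + m2) * (64 / 7) / 1 := by gcongr
      _ ≤ (16 * d + m2) * (64 / 7) + 1 := by linarith

end Summit.QuantumFields.BalabanUV.Beta.GAN24.SubAveragingFibre
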